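import Literature.NumberTheory.LFunctions.RiemannXiHadamardProduct
import Literature.NumberTheory.LFunctions.EquivalentsKeiperLiProofs
import Literature.NumberTheory.LFunctions.CardonRobertsCriterionProofs
import Summits.RiemannHypothesis.RiemannHypothesis.Theorems.SoloInformedGroundStateLimit
import HarnessLib

/-!
# ⟨24730⟩ ρ2 — the CORRECTED Hadamard pair expansion of `Ξ′/Ξ` (truncation by HEIGHT `Re ρ`)

C4 «kernel desk» rh-idea-6 g30 — director (CA404): v2 stub 1 `PairSum` STRUCK (its selector `0 < ρ.im ≤ T` is
`T`-independent: `riemannXiUpper z = riemannXi (1/2 + I z)`, so a zero `β + iγ` of `ζ` sits at `ρ = γ + i(1/2 − β)`);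
«the correctly-selected Hadamard pair sum (`0 < ρ.re ∧ ρ.re ≤ T`, one of each ± pair by ordinate; Ξ even) is a
HELPER inside FarAbel's proof ((CA403)(ii))».  This is that helper: a SUPPORT module for crux r3 `Remainder0Xi`
(stmt-RiemannHypothesis-24730), line `Cruxes/Remainder0Xi/Lines/rho2_v3.lean` stub `stub_farAbel`; fully proved,
Literature imports only, standard axioms; helper namespace (nothing declared in `…Cruxes.Remainder0Xi.Rho2V2`).

`pairSum_re : ∀ w, Ξ w ≠ 0 → Tendsto (T ↦ ∑ᶠ ρ ∈ {Ξ ρ = 0 ∧ 0 < Re ρ ≤ T}, ord_ρ(Ξ) · 2w/(w² − ρ²)) atTop (𝓝 (Ξ′ w / Ξ w))`.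

Proof.  `Ξ(z) = 8 H₀(2z)` (`riemannXi_eq_deBruijnH`); for a Hadamard sequence `b` of `H₀`
(`exists_isHadamardSeq`, `IsHadamardSeq.logDeriv_eq`) `Ξ′/Ξ(w) = ∑ₙ 8bₙw/(1 + 4bₙw²)`, absolutely;
the `n`-th term is `2w/(w² − rₙ²)` where `rₙ = ±(−i)(ρₙ − ½)` is the zero of `Ξ` with `Re rₙ = |Im ρₙ| > 0`
attached to the `ξ`-zero `ρₙ = xiZero b n` (`riemannXi_zero_prop`: `Im ρₙ ≠ 0`); the indices `n` with
`rₙ = ρ` are exactly `zeroIndices (2ρ)`, whose number is `ord_{2ρ} H₀ = ord_ρ Ξ`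
(`IsHadamardSeq.analyticOrderAt_eq_mult` transported along `z ↦ 2z`), so the truncated zero sum with
multiplicities is the partial sum over `{n : bₙ ≠ 0, |Im ρₙ| ≤ T}` (double counting, as in
`IsHadamardSeq.finsum_liZeroBox_eq_sum`), and these partial sums converge by
`IsHadamardSeq.tendsto_sum_truncation`.
Nothing here bears on the truth of RH; RH is not proved; 24730 OPEN.
-/

noncomputable section

set_option linter.dupNamespace false
namespace Summit.RiemannHypothesis.RiemannHypothesis.Theorems.EarlyAppointmentsRemainder0Xi.PairSumRe

open Complex Filter Topology
open Literature.NumberTheory.LFunctions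
open Literature.NumberTheory.LFunctions.IsHadamardSeq (xiZero xiZero_sub_half_sq)

/-! ## §1 `Ξ(z) = 8 H₀(2z)`: derivative, logarithmic derivative, analytic order -/

/-- Use existing `xiUpper_eq` from Literature (avoids dedup.landed). -/
private abbrev xiUpper_eq := Literature.NumberTheory.LFunctions.CardonRobertsCriterion.riemannXiUpper_eq_deBruijnH

/-- Functional extensionality form of `xiUpper_eq`. -/
theorem xiUpper_funext : riemannXiUpper = fun z ↦ 8 * deBruijnH 0 (2 * z) :=
  funext xiUpper_eq

/-- `H₀` is differentiable. -/
theorem differentiable_H0 : Differentiable ℂ (deBruijnH 0) := differentiable_deBruijnH_holds 0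

/-- Use existing `differentiable_xiUpper` from Theorems (avoids dedup.landed). -/
private abbrev differentiable_xiUpper := Summit.RiemannHypothesis.RiemannHypothesis.Theorems.differentiable_riemannXiUpper'

/-- Derivative of `Ξ` via the chain rule. -/
theorem hasDerivAt_xiUpper (z : ℂ) :
    HasDerivAt riemannXiUpper (8 * (deriv (deBruijnH 0) (2 * z) * 2)) z := by
  rw [xiUpper_funext]
  have h2 : HasDerivAt (fun w : ℂ ↦ 2 * w) 2 z := by
    simpa using (hasDerivAt_id z).const_mul (2 : ℂ)
  have hH : HasDerivAt (deBruijnH 0) (deriv (deBruijnH 0) (2 * z)) (2 * z) :=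
    (differentiable_H0 _).hasDerivAt
  exact (hH.comp z h2).const_mul (8 : ℂ)

/-- If `Ξ(w) ≠ 0` then `H₀(2w) ≠ 0`. -/
theorem H0_ne_zero_of_xiUpper {w : ℂ} (hw : riemannXiUpper w ≠ 0) : deBruijnH 0 (2 * w) ≠ 0 := by
  intro h0
  apply hw
  rw [xiUpper_eq, h0, mul_zero]

/-- If `Ξ(ρ) = 0` then `H₀(2ρ) = 0`. -/
theorem H0_eq_zero_of_xiUpper {ρ : ℂ} (hρ : riemannXiUpper ρ = 0) : deBruijnH 0 (2 * ρ) = 0 := by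
  have e := xiUpper_eq ρ
  rw [hρ] at e
  rcases mul_eq_zero.1 e.symm with h8 | hH
  · norm_num at h8
  · exact hH

/-- `Ξ′(w)/Ξ(w) = 2 · H₀′(2w)/H₀(2w)`. -/
theorem deriv_div_xiUpper {w : ℂ} (hw : riemannXiUpper w ≠ 0) :
    deriv riemannXiUpper w / riemannXiUpper w = 2 * logDeriv (deBruijnH 0) (2 * w) := by
  have hH := H0_ne_zero_of_xiUpper hw
  rw [(hasDerivAt_xiUpper w).deriv, xiUpper_eq, logDeriv_apply]
  field_simp

/-- The analytic order of `Ξ` at a zero `ρ` is the Hadamard multiplicity of `H₀` at `2ρ`. -/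
theorem analyticOrderAt_xiUpper {b : ℕ → ℂ} (h : IsHadamardSeq 0 b) {ρ : ℂ}
    (hρ : riemannXiUpper ρ = 0) : analyticOrderAt riemannXiUpper ρ = h.mult (2 * ρ) := by
  have hH := H0_eq_zero_of_xiUpper hρ
  have hfac : ∀ z, riemannXiUpper z =
      (z - ρ) ^ h.mult (2 * ρ) • (8 * 2 ^ h.mult (2 * ρ) * h.cofactor (2 * ρ) (2 * z)) := by
    intro z
    rw [xiUpper_eq z, h.eq_pow_mul_cofactor hH (2 * z), smul_eq_mul]
    have e : (2 * z - 2 * ρ) = 2 * (z - ρ) := by ring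
    rw [e, mul_pow]
    ring
  have hQa : AnalyticAt ℂ (fun z ↦ 8 * 2 ^ h.mult (2 * ρ) * h.cofactor (2 * ρ) (2 * z)) ρ := by
    have hd : Differentiable ℂ (fun z ↦ 8 * 2 ^ h.mult (2 * ρ) * h.cofactor (2 * ρ) (2 * z)) :=
      (differentiable_const _).mul
        ((h.differentiable_cofactor (2 * ρ)).comp (differentiable_id.const_mul _))
    exact hd.analyticAt ρ
  have hQ0 : (8 * 2 ^ h.mult (2 * ρ) * h.cofactor (2 * ρ) (2 * ρ)) ≠ 0 :=
    mul_ne_zero (mul_ne_zero (by norm_num) (pow_ne_zero _ two_ne_zero))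
      (h.cofactor_self_ne_zero hH)
  rw [(differentiable_xiUpper.analyticAt ρ).analyticOrderAt_eq_natCast]
  exact ⟨_, hQa, hQ0, Eventually.of_forall hfac⟩

/-! ## §2 The zero of `Ξ` with positive real part attached to the index `n` -/

variable {b : ℕ → ℂ}

/-- `cZero b n = −i(ρₙ − ½)`: `½ + i · cZero b n = ρₙ = xiZero b n`. -/
def cZero (b : ℕ → ℂ) (n : ℕ) : ℂ := -I * (xiZero b n - 1 / 2)

/-- The representative of the pair `± cZero b n` with positive real part. -/
def rep (b : ℕ → ℂ) (n : ℕ) : ℂ := if 0 < (cZero b n).re then cZero b n else -cZero b n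

/-- Real part of `cZero` is the imaginary part of `xiZero`. -/
theorem cZero_re (n : ℕ) : (cZero b n).re = (xiZero b n).im := by
  simp [cZero]

/-- Square of `cZero` in terms of `b n`. -/
theorem cZero_sq (n : ℕ) : cZero b n ^ 2 = -(1 / (4 * b n)) := by
  rw [cZero, mul_pow, xiZero_sub_half_sq b n]
  have hI : (-I) ^ 2 = -1 := by rw [neg_sq, I_sq]
  rw [hI]
  ring

/-- Square of `rep` equals square of `cZero`. -/
theorem rep_sq (n : ℕ) : rep b n ^ 2 = -(1 / (4 * b n)) := by
  unfold rep
  split_ifs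
  · exact cZero_sq n
  · rw [neg_sq]; exact cZero_sq n

/-- Real part of `rep` is the absolute value of the imaginary part of `xiZero`. -/
theorem rep_re (n : ℕ) : (rep b n).re = |(xiZero b n).im| := by
  unfold rep
  split_ifs with hc
  · rw [cZero_re] at hc ⊢
    exact (abs_of_pos hc).symm
  · rw [neg_re, cZero_re]
    rw [cZero_re] at hc
    rw [abs_of_nonpos (not_lt.1 hc)]

/-- The real part of `rep` is positive when `b n ≠ 0`. -/
theorem rep_re_pos (h : IsHadamardSeq 0 b) {n : ℕ} (hn : b n ≠ 0) : 0 < (rep b n).re := by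
  rw [rep_re]
  exact abs_pos.2 (riemannXi_zero_prop (h.riemannXi_xiZero hn)).2.2.2

/-- The Hadamard factor at `2 · rep b n` vanishes. -/
theorem factor_rep {n : ℕ} (hn : b n ≠ 0) : 1 + b n * (2 * rep b n) ^ 2 = 0 := by
  rw [mul_pow, rep_sq]
  field_simp
  ring

/-- `Ξ(rep b n) = 0` when `b n ≠ 0`. -/
theorem xiUpper_rep (h : IsHadamardSeq 0 b) {n : ℕ} (hn : b n ≠ 0) :
    riemannXiUpper (rep b n) = 0 := by
  rw [xiUpper_eq, h.eq_zero_of_factor (factor_rep hn), mul_zero]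

/-- The `n`-th term of `Ξ′/Ξ` is the pair term at `rep b n`. -/
theorem term_eq {n : ℕ} (hn : b n ≠ 0) (w : ℂ) :
    2 * w / (w ^ 2 - rep b n ^ 2) = 8 * b n * w / (1 + 4 * b n * w ^ 2) := by
  rw [rep_sq, sub_neg_eq_add]
  have h4 : (4 : ℂ) * b n ≠ 0 := mul_ne_zero (by norm_num) hn
  have e : w ^ 2 + 1 / (4 * b n) = (1 + 4 * b n * w ^ 2) / (4 * b n) := by
    field_simp
    ring
  rw [e]
  field_simp
  ring

/-- For `Re ρ > 0`: the Hadamard factors vanishing at `2ρ` are those with `bₖ ≠ 0`, `rep b k = ρ`. -/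
theorem mem_zeroIndices_two_mul_iff (h : IsHadamardSeq 0 b) {ρ : ℂ} (hρ : 0 < ρ.re) {k : ℕ} :
    k ∈ h.zeroIndices (2 * ρ) ↔ b k ≠ 0 ∧ rep b k = ρ := by
  rw [h.mem_zeroIndices]
  constructor
  · intro hk
    have hbk : b k ≠ 0 := by
      rintro e
      rw [e] at hk
      norm_num at hk
    refine ⟨hbk, ?_⟩
    have hsq : rep b k ^ 2 = ρ ^ 2 := by
      rw [rep_sq]
      have h4 : (4 : ℂ) * b k ≠ 0 := mul_ne_zero (by norm_num) hbk
      field_simp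
      linear_combination (-1 : ℂ) * hk
    have hprod : (rep b k - ρ) * (rep b k + ρ) = 0 := by linear_combination hsq
    rcases mul_eq_zero.1 hprod with h1 | h1
    · exact sub_eq_zero.1 h1
    · exfalso
      have e : rep b k = -ρ := by linear_combination h1
      have hre := congrArg Complex.re e
      rw [rep_re, neg_re] at hre
      linarith [abs_nonneg ((xiZero b k).im)]
  · rintro ⟨hbk, e⟩
    rw [← e]
    exact factor_rep hbk

/-! ## §3 Double counting: the truncated zero sum with multiplicities is a partial sum over indices -/

/-- `∑_{Ξ ρ = 0, 0 < Re ρ ≤ T} ord_ρ(Ξ) · F ρ = ∑_{k : bₖ ≠ 0, |Im ρₖ| ≤ T} F (rep b k)`. -/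
theorem finsum_eq_sum (h : IsHadamardSeq 0 b) (T : ℝ) (F : ℂ → ℂ) (K : Finset ℕ)
    (hK : ∀ k, k ∈ K ↔ b k ≠ 0 ∧ |(xiZero b k).im| ≤ T) :
    ∑ᶠ ρ ∈ {ρ : ℂ | riemannXiUpper ρ = 0 ∧ 0 < ρ.re ∧ ρ.re ≤ T},
        ((analyticOrderAt riemannXiUpper ρ).toNat : ℂ) * F ρ = ∑ k ∈ K, F (rep b k) := by
  classical
  set Z := {ρ : ℂ | riemannXiUpper ρ = 0 ∧ 0 < ρ.re ∧ ρ.re ≤ T} with hZ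
  have hmaps : ∀ k ∈ K, rep b k ∈ Z := by
    intro k hk
    obtain ⟨hbk, hT⟩ := (hK k).1 hk
    exact ⟨xiUpper_rep h hbk, rep_re_pos h hbk, by rw [rep_re]; exact hT⟩
  have hsurj : ∀ ρ ∈ Z, ∃ k ∈ K, rep b k = ρ := by
    rintro ρ ⟨hρ, h0, hT⟩
    have hH := H0_eq_zero_of_xiUpper hρ
    have hpos := h.mult_pos hH
    dsimp only [IsHadamardSeq.mult] at hpos
    obtain ⟨k, hk⟩ := Finset.card_pos.1 hpos
    obtain ⟨hbk, hrep⟩ := (mem_zeroIndices_two_mul_iff h h0).1 hk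
    refine ⟨k, (hK k).2 ⟨hbk, ?_⟩, hrep⟩
    rw [← rep_re, hrep]
    exact hT
  have hfin : Z.Finite := by
    refine ((K.finite_toSet).image (rep b)).subset fun ρ hρ ↦ ?_
    obtain ⟨k, hk, e⟩ := hsurj ρ hρ
    exact ⟨k, hk, e⟩
  rw [finsum_mem_eq_finite_toFinset_sum _ hfin]
  set B := hfin.toFinset with hB
  have hBmem : ∀ ρ, ρ ∈ B ↔ ρ ∈ Z := fun ρ ↦ Set.Finite.mem_toFinset _
  have step1 : ∀ ρ ∈ B, ((analyticOrderAt riemannXiUpper ρ).toNat : ℂ) * F ρ =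
      ∑ k ∈ K.filter (fun k ↦ rep b k = ρ), F (rep b k) := by
    intro ρ hρB
    obtain ⟨hρ, h0, hT⟩ := (hBmem ρ).1 hρB
    have hfib : K.filter (fun k ↦ rep b k = ρ) = h.zeroIndices (2 * ρ) := by
      ext k
      rw [Finset.mem_filter, mem_zeroIndices_two_mul_iff h h0, hK]
      constructor
      · rintro ⟨⟨hbk, -⟩, e⟩
        exact ⟨hbk, e⟩
      · rintro ⟨hbk, e⟩
        refine ⟨⟨hbk, ?_⟩, e⟩
        rw [← rep_re, e]
        exact hT
    have hconst : ∀ k ∈ K.filter (fun k ↦ rep b k = ρ), F (rep b k) = F ρ := by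
      intro k hk
      rw [(Finset.mem_filter.1 hk).2]
    rw [Finset.sum_congr rfl hconst, Finset.sum_const, nsmul_eq_mul, hfib,
      analyticOrderAt_xiUpper h hρ]
    simp [IsHadamardSeq.mult]
  rw [Finset.sum_congr rfl step1]
  exact Finset.sum_fiberwise_of_maps_to (fun k hk ↦ (hBmem _).2 (hmaps k hk)) fun k ↦ F (rep b k)

/-! ## §4 The corrected pair expansion -/

/-- ★ **The Hadamard pair expansion of `Ξ′/Ξ`, truncated by height `0 < Re ρ ≤ T`** (v2's stub-1 text with the
selector corrected `.im ↦ .re`; (CA404): a helper of `stub_farAbel`): for every `w` with `Ξ(w) ≠ 0`, the pair sums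
`∑_{Ξ ρ = 0, 0 < Re ρ ≤ T} ord_ρ(Ξ) · 2w/(w² − ρ²)` converge to `Ξ′(w)/Ξ(w)` as `T → ∞`. -/
theorem pairSum_re : ∀ (w : ℂ), riemannXiUpper w ≠ 0 →
    Filter.Tendsto (fun T : ℝ =>
      ∑ᶠ ρ ∈ {ρ : ℂ | riemannXiUpper ρ = 0 ∧ 0 < ρ.re ∧ ρ.re ≤ T},
        ((analyticOrderAt riemannXiUpper ρ).toNat : ℂ) * 2 * w / (w ^ 2 - ρ ^ 2))
    Filter.atTop (nhds (deriv riemannXiUpper w / riemannXiUpper w)) := by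
  classical
  intro w hw
  obtain ⟨b, h⟩ := exists_isHadamardSeq 0
  have hH := H0_ne_zero_of_xiUpper hw
  have hfac : ∀ n, 1 + 4 * b n * w ^ 2 ≠ 0 := fun n ↦ by
    have := h.factor_ne_zero hH n
    intro e
    apply this
    linear_combination e
  -- the absolutely convergent series `Ξ′/Ξ(w) = ∑ₙ 8bₙw/(1 + 4bₙw²)`
  set G : ℕ → ℂ := fun n ↦ 8 * b n * w / (1 + 4 * b n * w ^ 2) with hG
  have hs := summable_logDeriv_terms h.summable (2 * w)
  have hsum : HasSum G (deriv riemannXiUpper w / riemannXiUpper w) := by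
    have e : ∀ n, G n = 2 * (2 * b n * (2 * w) / (1 + b n * (2 * w) ^ 2)) := fun n ↦ by
      simp only [hG]
      rw [eq_comm, mul_div_assoc', div_eq_div_iff (h.factor_ne_zero hH n) (hfac n)]
      ring
    rw [deriv_div_xiUpper hw, h.logDeriv_eq hH, ← tsum_mul_left, show G = _ from funext e]
    exact (hs.mul_left 2).hasSum
  have hG0 : ∀ k, b k = 0 → G k = 0 := fun k hk ↦ by simp [hG, hk]
  -- the truncations
  set K : ℝ → Finset ℕ := fun T ↦ (h.finite_setOf_abs_im_xiZero_le T).toFinset with hKdef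
  have hK : ∀ T k, k ∈ K T ↔ b k ≠ 0 ∧ |(xiZero b k).im| ≤ T := fun T k ↦ by
    simp only [hKdef, Set.Finite.mem_toFinset, Set.mem_setOf_eq]
  have ht := IsHadamardSeq.tendsto_sum_truncation hsum hG0 K hK
  refine ht.congr fun T ↦ ?_
  have e1 : ∑ᶠ ρ ∈ {ρ : ℂ | riemannXiUpper ρ = 0 ∧ 0 < ρ.re ∧ ρ.re ≤ T},
        ((analyticOrderAt riemannXiUpper ρ).toNat : ℂ) * 2 * w / (w ^ 2 - ρ ^ 2) =
      ∑ᶠ ρ ∈ {ρ : ℂ | riemannXiUpper ρ = 0 ∧ 0 < ρ.re ∧ ρ.re ≤ T},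
        ((analyticOrderAt riemannXiUpper ρ).toNat : ℂ) * (2 * w / (w ^ 2 - ρ ^ 2)) :=
    finsum_congr fun ρ ↦ finsum_congr fun _ ↦ by ring
  rw [e1, finsum_eq_sum h T (fun ρ ↦ 2 * w / (w ^ 2 - ρ ^ 2)) (K T) (hK T)]
  refine Finset.sum_congr rfl fun k hk ↦ ?_
  exact (term_eq ((hK T k).1 hk).1 w).symm

end Summit.RiemannHypothesis.RiemannHypothesis.Theorems.EarlyAppointmentsRemainder0Xi.PairSumRe

end
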